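import Literature.Geometry.Riemannian.LowEntropyHypersurfacesFourProofs
import Literature.Geometry.Riemannian.SphericalCylinderEntropy
import Mathlib
import HarnessLib

/-!
# The conformal map `Φ(z) = e^{z₅} z'` of the cylinder `S⁴ × ℝ ⊂ ℝ⁶`: bi-Lipschitz bounds and the
# push-forward inequality for `𝓗⁴` (helper for stubs 3, 4, 5 of line `conformal-kernel-domination`,
# crux `CylinderEntropy.SliceIsolation`, item stmt-SmoothPoincare4-7632)

The line pushes a cross-section `A` of the round cylinder `N = {z ∈ ℝ⁶ | ∑_{i<5} zᵢ² = 1}` into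
`ℝ⁵` by the conformal diffeomorphism `Φ(x, s) = eˢ x`, written in the registered stubs as the
literal lambda `fun z ↦ toLp 2 (fun i : Fin 5 ↦ exp (z 5) * z (castSucc i))`. No `def` is
introduced: every statement is about an arbitrary `Φ : ℝ⁶ → ℝ⁵` under the hypothesis
`hΦ : ∀ z, Φ z = exp (z 5) • truncL z` (`truncL` = drop the last coordinate,
`SphericalCylinderEntropy.lean`); the literal lambda satisfies it by `conformalMap_apply_eq_smul`,
so a stub file instantiates `hΦ := conformalMap_apply_eq_smul`. Proved here:

* `norm_conformalMap_sub_sq` — for `z, w ∈ N` with heights `s, s'`: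
  `‖Φ z − Φ w‖² = (eˢ − e^{s'})² + eˢ e^{s'} ‖z' − w'‖²`, and `‖z − w‖² = ‖z' − w'‖² + (s − s')²`;
* the **exact bi-Lipschitz bounds on `N`**: `e^{min(s,s')} ‖z − w‖ ≤ ‖Φ z − Φ w‖ ≤ e^{max(s,s')} ‖z − w‖`
  (`le_norm_conformalMap_sub`, `norm_conformalMap_sub_le`, from the tangent-line inequalities
  `eˢ(s' − s) ≤ e^{s'} − eˢ ≤ e^{s'}(s' − s)`); hence `Φ` is `e^{b}`-Lipschitz on `N ∩ {z₅ ≤ b}`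
  (`lipschitzOnWith_conformalMap`), injective on `N` (`injOn_conformalMap`), and maps measurable
  subsets of `N` to measurable sets (`measurableSet_image_conformalMap`, Lusin–Souslin);
* the **push-forward inequality** (Federer 2.10.11 in measure form): for `h` measurable and
  `K`-Lipschitz on `S`, `𝓗ᵈ⌊h(S) ≤ Kᵈ · h_#(𝓗ᵈ⌊S)` (`hausdorffMeasure_restrict_image_le`,
  `euclideanHausdorffMeasure_restrict_image_le`), hence `∫_{h(S)} g d𝓗ᵈ ≤ Kᵈ ∫_S g ∘ h d𝓗ᵈ` for
  measurable `g ≥ 0` (`setLIntegral_image_le_of_lipschitzOnWith[_euclidean]`), for Mathlib's `μH[d]`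
  and the normalised `μHE[d]`; for `Φ` on `A ⊆ N ∩ {z₅ ≤ b}`:
  `∫_{Φ(A)} g dμHE[4] ≤ e^{4b} ∫_A g(Φ z) dμHE[4]` (`setLIntegral_conformalMap_image_le[_hausdorff]`,
  literal-lambda form `helper_conformalPushforward` = the registered helper sub-goal) and
  `μHE[4](Φ(A)) ≤ e^{4b} μHE[4](A)`.

Everything is proved; no definition, no named fact, no notation.

References: H. Federer, *Geometric Measure Theory* (1969), 2.10.11 [Federer1969];
T. H. Colding, W. P. Minicozzi II, Ann. of Math. 175 (2012), (0.5) [ColdingMinicozzi2012].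
-/

noncomputable section

-- the registered namespace `Summit.SmoothPoincare4.SmoothPoincare4.Theorems…` repeats a component
set_option linter.dupNamespace false

open MeasureTheory Set Function
open scoped ENNReal NNReal Topology RealInnerProductSpace

namespace Summit.SmoothPoincare4.SmoothPoincare4.Theorems.CylinderEntropySliceIsolation

open Literature.Geometry.Riemannian
open Literature.Geometry.Riemannian.SphericalCylinderEntropy (truncL truncL_apply lipschitz_truncL)

/-! ## The map `Φ` -/

/-- The literal conformal map of the registered stubs is `z ↦ e^{z₅} • z'` with `z' = truncL z`
the first five coordinates. [folklore] -/
theorem conformalMap_apply_eq_smul (z : EuclideanSpace ℝ (Fin 6)) :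
    (WithLp.toLp 2 (fun i : Fin 5 => Real.exp (z 5) * z (Fin.castSucc i)) :
        EuclideanSpace ℝ (Fin 5)) = Real.exp (z 5) • truncL z := by
  ext i
  simp [truncL_apply]

variable {Φ : EuclideanSpace ℝ (Fin 6) → EuclideanSpace ℝ (Fin 5)}

/-- The conformal map `z ↦ e^{z₅} • truncL z` is continuous on `ℝ⁶`. [folklore] -/
theorem continuous_conformalMap (hΦ : ∀ z, Φ z = Real.exp (z 5) • truncL z) :
    Continuous fun z : EuclideanSpace ℝ (Fin 6) => Φ z := by
  rw [funext hΦ]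
  fun_prop

/-- The conformal map `z ↦ e^{z₅} • truncL z` is (Borel) measurable. [folklore] -/
theorem measurable_conformalMap (hΦ : ∀ z, Φ z = Real.exp (z 5) • truncL z) :
    Measurable fun z : EuclideanSpace ℝ (Fin 6) => Φ z :=
  (continuous_conformalMap hΦ).measurable

/-- On the cylinder `N`, the first five coordinates form a unit vector: `‖truncL z‖ = 1`.
[folklore] -/
theorem norm_truncL_eq_one {z : EuclideanSpace ℝ (Fin 6)}
    (hz : ∑ i : Fin 5, z (Fin.castSucc i) ^ 2 = 1) : ‖truncL z‖ = 1 := by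
  have h : ‖truncL z‖ ^ 2 = 1 := by
    rw [EuclideanSpace.norm_sq_eq]
    simpa [truncL_apply, sq_abs] using hz
  exact (pow_eq_one_iff_of_nonneg (norm_nonneg _) two_ne_zero).1 h

/-- On the cylinder, `‖Φ z‖ = e^{z₅}`: slices go to round spheres about `0`. [folklore] -/
theorem norm_conformalMap (hΦ : ∀ z, Φ z = Real.exp (z 5) • truncL z)
    {z : EuclideanSpace ℝ (Fin 6)} (hz : ∑ i : Fin 5, z (Fin.castSucc i) ^ 2 = 1) :
    ‖Φ z‖ = Real.exp (z 5) := by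
  rw [hΦ, norm_smul, norm_truncL_eq_one hz, mul_one, Real.norm_eq_abs,
    abs_of_pos (Real.exp_pos _)]

/-- Pythagoras in coordinates: `‖z − w‖² = ‖z' − w'‖² + (z₅ − w₅)²`. [folklore] -/
theorem norm_sub_sq_eq_norm_truncL_sub_sq_add (z w : EuclideanSpace ℝ (Fin 6)) :
    ‖z - w‖ ^ 2 = ‖truncL z - truncL w‖ ^ 2 + (z 5 - w 5) ^ 2 := by
  rw [← map_sub, EuclideanSpace.norm_sq_eq, EuclideanSpace.norm_sq_eq, Fin.sum_univ_castSucc]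
  simp only [truncL_apply, Real.norm_eq_abs, sq_abs, WithLp.ofLp_sub, Pi.sub_apply]
  rfl

/-- **The key identity.** For `z, w ∈ N` with heights `s = z₅`, `s' = w₅`:
`‖Φ z − Φ w‖² = (eˢ − e^{s'})² + eˢ e^{s'} ‖z' − w'‖²` (expand `‖eˢ x − e^{s'} x'‖²` for unit
vectors `x, x'` and use `‖x − x'‖² = 2 − 2⟨x, x'⟩`). [folklore] -/
theorem norm_conformalMap_sub_sq (hΦ : ∀ z, Φ z = Real.exp (z 5) • truncL z)
    {z w : EuclideanSpace ℝ (Fin 6)} (hz : ∑ i : Fin 5, z (Fin.castSucc i) ^ 2 = 1)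
    (hw : ∑ i : Fin 5, w (Fin.castSucc i) ^ 2 = 1) :
    ‖Φ z - Φ w‖ ^ 2 = (Real.exp (z 5) - Real.exp (w 5)) ^ 2 +
      Real.exp (z 5) * Real.exp (w 5) * ‖truncL z - truncL w‖ ^ 2 := by
  rw [hΦ, hΦ, norm_sub_sq_real, norm_sub_sq_real, norm_smul, norm_smul, norm_truncL_eq_one hz,
    norm_truncL_eq_one hw, real_inner_smul_left, real_inner_smul_right, Real.norm_eq_abs,
    Real.norm_eq_abs, abs_of_pos (Real.exp_pos _), abs_of_pos (Real.exp_pos _)]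
  ring

/-! ## One-variable exponential bounds -/

/-- The two tangent-line inequalities of the exponential:
`eˢ (s' − s) ≤ e^{s'} − eˢ ≤ e^{s'} (s' − s)` for all real `s, s'` (both from `1 + u ≤ eᵘ`).
[folklore] -/
theorem exp_sub_exp_bounds (s s' : ℝ) :
    Real.exp s * (s' - s) ≤ Real.exp s' - Real.exp s ∧
      Real.exp s' - Real.exp s ≤ Real.exp s' * (s' - s) := by
  constructor
  · have h1 := Real.add_one_le_exp (s' - s)
    have h2 := mul_le_mul_of_nonneg_left h1 (Real.exp_pos s).le
    rw [← Real.exp_add, show s + (s' - s) = s' by ring] at h2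
    linarith
  · have h1 := Real.add_one_le_exp (s - s')
    have h2 := mul_le_mul_of_nonneg_left h1 (Real.exp_pos s').le
    rw [← Real.exp_add, show s' + (s - s') = s by ring] at h2
    linarith

/-- `(eˢ − e^{s'})² ≤ e^{2 max(s,s')} (s − s')²`. [folklore] -/
theorem sq_exp_sub_exp_le (s s' : ℝ) :
    (Real.exp s - Real.exp s') ^ 2 ≤ Real.exp (max s s') ^ 2 * (s - s') ^ 2 := by
  rcases le_total s s' with h | h
  · obtain ⟨h1, h2⟩ := exp_sub_exp_bounds s s'
    have h0 : 0 ≤ Real.exp s * (s' - s) := mul_nonneg (Real.exp_pos s).le (sub_nonneg.2 h)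
    rw [max_eq_right h]
    calc (Real.exp s - Real.exp s') ^ 2 = (Real.exp s' - Real.exp s) ^ 2 := by ring
      _ ≤ (Real.exp s' * (s' - s)) ^ 2 := pow_le_pow_left₀ (h0.trans h1) h2 2
      _ = Real.exp s' ^ 2 * (s - s') ^ 2 := by ring
  · obtain ⟨h1, h2⟩ := exp_sub_exp_bounds s' s
    have h0 : 0 ≤ Real.exp s' * (s - s') := mul_nonneg (Real.exp_pos s').le (sub_nonneg.2 h)
    rw [max_eq_left h]
    calc (Real.exp s - Real.exp s') ^ 2 ≤ (Real.exp s * (s - s')) ^ 2 :=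
          pow_le_pow_left₀ (h0.trans h1) h2 2
      _ = Real.exp s ^ 2 * (s - s') ^ 2 := by ring

/-- `e^{2 min(s,s')} (s − s')² ≤ (eˢ − e^{s'})²`. [folklore] -/
theorem sq_exp_min_mul_le (s s' : ℝ) :
    Real.exp (min s s') ^ 2 * (s - s') ^ 2 ≤ (Real.exp s - Real.exp s') ^ 2 := by
  rcases le_total s s' with h | h
  · obtain ⟨h1, -⟩ := exp_sub_exp_bounds s s'
    have h0 : 0 ≤ Real.exp s * (s' - s) := mul_nonneg (Real.exp_pos s).le (sub_nonneg.2 h)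
    rw [min_eq_left h]
    calc Real.exp s ^ 2 * (s - s') ^ 2 = (Real.exp s * (s' - s)) ^ 2 := by ring
      _ ≤ (Real.exp s' - Real.exp s) ^ 2 := pow_le_pow_left₀ h0 h1 2
      _ = (Real.exp s - Real.exp s') ^ 2 := by ring
  · obtain ⟨h1, -⟩ := exp_sub_exp_bounds s' s
    have h0 : 0 ≤ Real.exp s' * (s - s') := mul_nonneg (Real.exp_pos s').le (sub_nonneg.2 h)
    rw [min_eq_right h]
    calc Real.exp s' ^ 2 * (s - s') ^ 2 = (Real.exp s' * (s - s')) ^ 2 := by ring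
      _ ≤ (Real.exp s - Real.exp s') ^ 2 := pow_le_pow_left₀ h0 h1 2

/-- `eˢ e^{s'} ≤ e^{2 max(s,s')}`. [folklore] -/
theorem exp_mul_exp_le_sq_exp_max (s s' : ℝ) :
    Real.exp s * Real.exp s' ≤ Real.exp (max s s') ^ 2 := by
  rw [sq]
  exact mul_le_mul (Real.exp_le_exp.2 (le_max_left _ _)) (Real.exp_le_exp.2 (le_max_right _ _))
    (Real.exp_pos _).le (Real.exp_pos _).le

/-- `e^{2 min(s,s')} ≤ eˢ e^{s'}`. [folklore] -/
theorem sq_exp_min_le_exp_mul_exp (s s' : ℝ) :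
    Real.exp (min s s') ^ 2 ≤ Real.exp s * Real.exp s' := by
  rw [sq]
  exact mul_le_mul (Real.exp_le_exp.2 (min_le_left _ _)) (Real.exp_le_exp.2 (min_le_right _ _))
    (Real.exp_pos _).le (Real.exp_pos _).le

/-! ## The bi-Lipschitz bounds on `N` -/

/-- **Upper Lipschitz bound**: for `z, w ∈ N`, `‖Φ z − Φ w‖ ≤ e^{max(z₅, w₅)} ‖z − w‖`. [folklore] -/
theorem norm_conformalMap_sub_le (hΦ : ∀ z, Φ z = Real.exp (z 5) • truncL z)
    {z w : EuclideanSpace ℝ (Fin 6)} (hz : ∑ i : Fin 5, z (Fin.castSucc i) ^ 2 = 1)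
    (hw : ∑ i : Fin 5, w (Fin.castSucc i) ^ 2 = 1) :
    ‖Φ z - Φ w‖ ≤ Real.exp (max (z 5) (w 5)) * ‖z - w‖ := by
  have hM := exp_mul_exp_le_sq_exp_max (z 5) (w 5)
  have hE := sq_exp_sub_exp_le (z 5) (w 5)
  have hD : 0 ≤ ‖truncL z - truncL w‖ ^ 2 := sq_nonneg _
  refine (sq_le_sq₀ (norm_nonneg _) (by positivity)).1 ?_
  rw [norm_conformalMap_sub_sq hΦ hz hw, mul_pow, norm_sub_sq_eq_norm_truncL_sub_sq_add]
  nlinarith [mul_le_mul_of_nonneg_right hM hD]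

/-- **Lower Lipschitz bound**: for `z, w ∈ N`, `e^{min(z₅, w₅)} ‖z − w‖ ≤ ‖Φ z − Φ w‖`. [folklore] -/
theorem le_norm_conformalMap_sub (hΦ : ∀ z, Φ z = Real.exp (z 5) • truncL z)
    {z w : EuclideanSpace ℝ (Fin 6)} (hz : ∑ i : Fin 5, z (Fin.castSucc i) ^ 2 = 1)
    (hw : ∑ i : Fin 5, w (Fin.castSucc i) ^ 2 = 1) :
    Real.exp (min (z 5) (w 5)) * ‖z - w‖ ≤ ‖Φ z - Φ w‖ := by
  have hm := sq_exp_min_le_exp_mul_exp (z 5) (w 5)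
  have hE := sq_exp_min_mul_le (z 5) (w 5)
  have hD : 0 ≤ ‖truncL z - truncL w‖ ^ 2 := sq_nonneg _
  refine (sq_le_sq₀ (by positivity) (norm_nonneg _)).1 ?_
  rw [norm_conformalMap_sub_sq hΦ hz hw, mul_pow, norm_sub_sq_eq_norm_truncL_sub_sq_add]
  nlinarith [mul_le_mul_of_nonneg_right hm hD]

/-- **`Φ` is `e^{b}`-Lipschitz on `N ∩ {z₅ ≤ b}`.** [folklore] -/
theorem lipschitzOnWith_conformalMap (hΦ : ∀ z, Φ z = Real.exp (z 5) • truncL z) (b : ℝ) :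
    LipschitzOnWith (Real.toNNReal (Real.exp b)) Φ
      ({z : EuclideanSpace ℝ (Fin 6) | ∑ i : Fin 5, z (Fin.castSucc i) ^ 2 = 1} ∩
        {z : EuclideanSpace ℝ (Fin 6) | z 5 ≤ b}) := by
  refine LipschitzOnWith.of_dist_le_mul fun z hz w hw => ?_
  rw [dist_eq_norm, dist_eq_norm, Real.coe_toNNReal _ (Real.exp_pos b).le]
  calc ‖Φ z - Φ w‖ ≤ Real.exp (max (z 5) (w 5)) * ‖z - w‖ := norm_conformalMap_sub_le hΦ hz.1 hw.1
    _ ≤ Real.exp b * ‖z - w‖ := by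
        gcongr
        exact max_le hz.2 hw.2

/-- A subset `A ⊆ N` of height `≤ b` inherits the `e^{b}`-Lipschitz bound. [folklore] -/
theorem lipschitzOnWith_conformalMap_of_subset (hΦ : ∀ z, Φ z = Real.exp (z 5) • truncL z)
    {A : Set (EuclideanSpace ℝ (Fin 6))} {b : ℝ}
    (hA : A ⊆ {z : EuclideanSpace ℝ (Fin 6) | ∑ i : Fin 5, z (Fin.castSucc i) ^ 2 = 1})
    (hb : ∀ z ∈ A, z 5 ≤ b) : LipschitzOnWith (Real.toNNReal (Real.exp b)) Φ A :=
  (lipschitzOnWith_conformalMap hΦ b).mono fun z hz => ⟨hA hz, hb z hz⟩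

/-- **`Φ` is injective on `N`** (lower Lipschitz bound). [folklore] -/
theorem injOn_conformalMap (hΦ : ∀ z, Φ z = Real.exp (z 5) • truncL z) :
    InjOn Φ {z : EuclideanSpace ℝ (Fin 6) | ∑ i : Fin 5, z (Fin.castSucc i) ^ 2 = 1} := by
  intro z hz w hw hzw
  have h := le_norm_conformalMap_sub hΦ hz hw
  rw [hzw, sub_self, norm_zero] at h
  have h0 : ‖z - w‖ ≤ 0 :=
    le_of_mul_le_mul_left (by rwa [mul_zero]) (Real.exp_pos (min (z 5) (w 5)))
  exact sub_eq_zero.1 (norm_le_zero_iff.1 h0)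

/-- `Φ` maps measurable subsets of `N` to measurable subsets of `ℝ⁵` (Lusin–Souslin: `Φ` is
continuous, and injective on `N`). [folklore] -/
theorem measurableSet_image_conformalMap (hΦ : ∀ z, Φ z = Real.exp (z 5) • truncL z)
    {A : Set (EuclideanSpace ℝ (Fin 6))}
    (hA : A ⊆ {z : EuclideanSpace ℝ (Fin 6) | ∑ i : Fin 5, z (Fin.castSucc i) ^ 2 = 1})
    (hAm : MeasurableSet A) : MeasurableSet (Φ '' A) :=
  hAm.image_of_continuousOn_injOn (continuous_conformalMap hΦ).continuousOn
    ((injOn_conformalMap hΦ).mono hA)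

/-! ## The push-forward inequality for Lipschitz maps (Federer 2.10.11, measure form) -/

section Pushforward


variable {X Y : Type*} [EMetricSpace X] [MeasurableSpace X] [BorelSpace X]
  [EMetricSpace Y] [MeasurableSpace Y] [BorelSpace Y]

/-- **`𝓗ᵈ⌊h(S) ≤ Kᵈ · h_#(𝓗ᵈ⌊S)`** for a measurable map `h` which is `K`-Lipschitz on `S`
(Mathlib's un-normalised `μH[d]`): on a measurable `B`, `B ∩ h(S) = h(h⁻¹(B) ∩ S)` and Federer
2.10.11 (`LipschitzOnWith.hausdorffMeasure_image_le`) on the subset `h⁻¹(B) ∩ S`.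
[cite: Federer1969, 2.10.11] -/
theorem hausdorffMeasure_restrict_image_le {h : X → Y} (hmeas : Measurable h) {K : ℝ≥0}
    {S : Set X} (hK : LipschitzOnWith K h S) {d : ℝ} (hd : 0 ≤ d) :
    (μH[d] : Measure Y).restrict (h '' S) ≤
      ((K : ℝ≥0∞) ^ d) • ((μH[d] : Measure X).restrict S).map h := by
  rw [Measure.le_iff]
  intro B hB
  rw [Measure.restrict_apply hB, Measure.smul_apply, Measure.map_apply hmeas hB,
    Measure.restrict_apply (hB.preimage hmeas), smul_eq_mul]
  have hsub : B ∩ h '' S ⊆ h '' (h ⁻¹' B ∩ S) := by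
    rintro _ ⟨hyB, x, hxS, rfl⟩
    exact ⟨x, ⟨hyB, hxS⟩, rfl⟩
  exact (measure_mono hsub).trans ((hK.mono inter_subset_right).hausdorffMeasure_image_le hd)

/-- **`∫_{h(S)} g d𝓗ᵈ ≤ Kᵈ ∫_S (g ∘ h) d𝓗ᵈ`** for measurable `g ≥ 0` and `h` measurable,
`K`-Lipschitz on `S` (`μH[d]`). [cite: Federer1969, 2.10.11] -/
theorem setLIntegral_image_le_of_lipschitzOnWith {h : X → Y} (hmeas : Measurable h) {K : ℝ≥0}
    {S : Set X} (hK : LipschitzOnWith K h S) {d : ℝ} (hd : 0 ≤ d) {g : Y → ℝ≥0∞}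
    (hg : Measurable g) :
    ∫⁻ y in h '' S, g y ∂(μH[d] : Measure Y) ≤
      (K : ℝ≥0∞) ^ d * ∫⁻ x in S, g (h x) ∂(μH[d] : Measure X) := by
  calc ∫⁻ y in h '' S, g y ∂(μH[d] : Measure Y)
      ≤ ∫⁻ y, g y ∂(((K : ℝ≥0∞) ^ d) • ((μH[d] : Measure X).restrict S).map h) :=
        lintegral_mono' (hausdorffMeasure_restrict_image_le hmeas hK hd) le_rfl
    _ = (K : ℝ≥0∞) ^ d * ∫⁻ x in S, g (h x) ∂(μH[d] : Measure X) := by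
        rw [lintegral_smul_measure, lintegral_map hg hmeas, smul_eq_mul]

/-- Lipschitz-on maps increase the normalised measure `μHE[d]` of the set by at most `Kᵈ`.
[cite: Federer1969, 2.10.11] -/
theorem euclideanHausdorffMeasure_image_le_of_lipschitzOnWith {h : X → Y} {K : ℝ≥0} {S : Set X}
    (hK : LipschitzOnWith K h S) (d : ℕ) :
    (μHE[d] : Measure Y) (h '' S) ≤ (K : ℝ≥0∞) ^ d * (μHE[d] : Measure X) S := by
  have key := hK.hausdorffMeasure_image_le (Nat.cast_nonneg d)
  rw [ENNReal.rpow_natCast] at key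
  rw [Measure.euclideanHausdorffMeasure_def, Measure.euclideanHausdorffMeasure_def,
    Measure.smul_apply, Measure.smul_apply, ENNReal.smul_def, ENNReal.smul_def, smul_eq_mul,
    smul_eq_mul, mul_left_comm]
  exact mul_le_mul' le_rfl key

/-- **`μHE[d]⌊h(S) ≤ Kᵈ · h_#(μHE[d]⌊S)`** (normalised Hausdorff measure).
[cite: Federer1969, 2.10.11] -/
theorem euclideanHausdorffMeasure_restrict_image_le {h : X → Y} (hmeas : Measurable h) {K : ℝ≥0}
    {S : Set X} (hK : LipschitzOnWith K h S) (d : ℕ) :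
    (μHE[d] : Measure Y).restrict (h '' S) ≤
      ((K : ℝ≥0∞) ^ d) • ((μHE[d] : Measure X).restrict S).map h := by
  rw [Measure.le_iff]
  intro B hB
  rw [Measure.restrict_apply hB, Measure.smul_apply, Measure.map_apply hmeas hB,
    Measure.restrict_apply (hB.preimage hmeas), smul_eq_mul]
  have hsub : B ∩ h '' S ⊆ h '' (h ⁻¹' B ∩ S) := by
    rintro _ ⟨hyB, x, hxS, rfl⟩
    exact ⟨x, ⟨hyB, hxS⟩, rfl⟩
  exact (measure_mono hsub).trans
    (euclideanHausdorffMeasure_image_le_of_lipschitzOnWith (hK.mono inter_subset_right) d)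

/-- **`∫_{h(S)} g dμHE[d] ≤ Kᵈ ∫_S (g ∘ h) dμHE[d]`** for measurable `g ≥ 0` and `h` measurable,
`K`-Lipschitz on `S`. [cite: Federer1969, 2.10.11] -/
theorem setLIntegral_image_le_of_lipschitzOnWith_euclidean {h : X → Y} (hmeas : Measurable h)
    {K : ℝ≥0} {S : Set X} (hK : LipschitzOnWith K h S) (d : ℕ) {g : Y → ℝ≥0∞}
    (hg : Measurable g) :
    ∫⁻ y in h '' S, g y ∂(μHE[d] : Measure Y) ≤
      (K : ℝ≥0∞) ^ d * ∫⁻ x in S, g (h x) ∂(μHE[d] : Measure X) := by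
  calc ∫⁻ y in h '' S, g y ∂(μHE[d] : Measure Y)
      ≤ ∫⁻ y, g y ∂(((K : ℝ≥0∞) ^ d) • ((μHE[d] : Measure X).restrict S).map h) :=
        lintegral_mono' (euclideanHausdorffMeasure_restrict_image_le hmeas hK d) le_rfl
    _ = (K : ℝ≥0∞) ^ d * ∫⁻ x in S, g (h x) ∂(μHE[d] : Measure X) := by
        rw [lintegral_smul_measure, lintegral_map hg hmeas, smul_eq_mul]

/-- The constant: `(e^{b})⁴ = e^{4b}` in `ℝ≥0∞`. [folklore] -/
theorem coe_toNNReal_exp_pow_four (b : ℝ) :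
    ((Real.toNNReal (Real.exp b) : ℝ≥0) : ℝ≥0∞) ^ 4 = ENNReal.ofReal (Real.exp (4 * b)) := by
  rw [show (4 : ℝ) * b = ((4 : ℕ) : ℝ) * b by norm_num, Real.exp_nat_mul,
    ENNReal.ofReal_pow (Real.exp_pos b).le]
  rfl

end Pushforward

/-! ## The push-forward inequality for `Φ` -/

/-- **Push-forward inequality for `Φ`, normalised measure.** For `A ⊆ N ∩ {z₅ ≤ b}` and every
measurable `g : ℝ⁵ → [0, ∞]`: `∫_{Φ(A)} g dμHE[4] ≤ e^{4b} ∫_A g(Φ z) dμHE[4](z)`. [folklore] -/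
theorem setLIntegral_conformalMap_image_le (hΦ : ∀ z, Φ z = Real.exp (z 5) • truncL z)
    {A : Set (EuclideanSpace ℝ (Fin 6))} {b : ℝ}
    (hA : A ⊆ {z : EuclideanSpace ℝ (Fin 6) | ∑ i : Fin 5, z (Fin.castSucc i) ^ 2 = 1})
    (hb : ∀ z ∈ A, z 5 ≤ b) {g : EuclideanSpace ℝ (Fin 5) → ℝ≥0∞} (hg : Measurable g) :
    ∫⁻ w in Φ '' A, g w ∂(μHE[4] : Measure (EuclideanSpace ℝ (Fin 5))) ≤
      ENNReal.ofReal (Real.exp (4 * b)) *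
        ∫⁻ z in A, g (Φ z) ∂(μHE[4] : Measure (EuclideanSpace ℝ (Fin 6))) := by
  rw [← coe_toNNReal_exp_pow_four]
  exact setLIntegral_image_le_of_lipschitzOnWith_euclidean (measurable_conformalMap hΦ)
    (lipschitzOnWith_conformalMap_of_subset hΦ hA hb) 4 hg

/-- **Push-forward inequality for `Φ`, Mathlib's `μH[4]`.** For `A ⊆ N ∩ {z₅ ≤ b}` and every
measurable `g : ℝ⁵ → [0, ∞]`: `∫_{Φ(A)} g dμH[4] ≤ e^{4b} ∫_A g(Φ z) dμH[4](z)`. [folklore] -/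
theorem setLIntegral_conformalMap_image_le_hausdorff (hΦ : ∀ z, Φ z = Real.exp (z 5) • truncL z)
    {A : Set (EuclideanSpace ℝ (Fin 6))} {b : ℝ}
    (hA : A ⊆ {z : EuclideanSpace ℝ (Fin 6) | ∑ i : Fin 5, z (Fin.castSucc i) ^ 2 = 1})
    (hb : ∀ z ∈ A, z 5 ≤ b) {g : EuclideanSpace ℝ (Fin 5) → ℝ≥0∞} (hg : Measurable g) :
    ∫⁻ w in Φ '' A, g w ∂(μH[4] : Measure (EuclideanSpace ℝ (Fin 5))) ≤
      ENNReal.ofReal (Real.exp (4 * b)) *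
        ∫⁻ z in A, g (Φ z) ∂(μH[4] : Measure (EuclideanSpace ℝ (Fin 6))) := by
  have h := setLIntegral_image_le_of_lipschitzOnWith (measurable_conformalMap hΦ)
    (lipschitzOnWith_conformalMap_of_subset hΦ hA hb) (d := 4) (by norm_num) hg
  rwa [ENNReal.rpow_ofNat, coe_toNNReal_exp_pow_four] at h

/-- **Area distortion**: `μHE[4](Φ(A)) ≤ e^{4b} μHE[4](A)` for `A ⊆ N ∩ {z₅ ≤ b}`. [folklore] -/
theorem euclideanHausdorffMeasure_conformalMap_image_le
    (hΦ : ∀ z, Φ z = Real.exp (z 5) • truncL z) {A : Set (EuclideanSpace ℝ (Fin 6))} {b : ℝ}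
    (hA : A ⊆ {z : EuclideanSpace ℝ (Fin 6) | ∑ i : Fin 5, z (Fin.castSucc i) ^ 2 = 1})
    (hb : ∀ z ∈ A, z 5 ≤ b) :
    (μHE[4] : Measure (EuclideanSpace ℝ (Fin 5))) (Φ '' A) ≤
      ENNReal.ofReal (Real.exp (4 * b)) * (μHE[4] : Measure (EuclideanSpace ℝ (Fin 6))) A := by
  rw [← coe_toNNReal_exp_pow_four]
  exact euclideanHausdorffMeasure_image_le_of_lipschitzOnWith
    (lipschitzOnWith_conformalMap_of_subset hΦ hA hb) 4

/-- **Area distortion, `μH[4]`**: `μH[4](Φ(A)) ≤ e^{4b} μH[4](A)` for `A ⊆ N ∩ {z₅ ≤ b}`.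
[folklore] -/
theorem hausdorffMeasure_conformalMap_image_le (hΦ : ∀ z, Φ z = Real.exp (z 5) • truncL z)
    {A : Set (EuclideanSpace ℝ (Fin 6))} {b : ℝ}
    (hA : A ⊆ {z : EuclideanSpace ℝ (Fin 6) | ∑ i : Fin 5, z (Fin.castSucc i) ^ 2 = 1})
    (hb : ∀ z ∈ A, z 5 ≤ b) :
    (μH[4] : Measure (EuclideanSpace ℝ (Fin 5))) (Φ '' A) ≤
      ENNReal.ofReal (Real.exp (4 * b)) * (μH[4] : Measure (EuclideanSpace ℝ (Fin 6))) A := by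
  have h := (lipschitzOnWith_conformalMap_of_subset hΦ hA hb).hausdorffMeasure_image_le
    (d := 4) (by norm_num)
  rwa [ENNReal.rpow_ofNat, coe_toNNReal_exp_pow_four] at h

/-- **Registered helper sub-goal** (the literal form used by the stubs): the push-forward
inequality for the lambda `fun z ↦ toLp 2 (fun i ↦ exp (z 5) * z (castSucc i))` of the registered
signatures, `A ⊆ N ∩ {z₅ ≤ b}`, measurable `g`, normalised measure `μHE[4]`. [folklore] -/
theorem helper_conformalPushforward : ∀ (b : ℝ) (A : Set (EuclideanSpace ℝ (Fin 6)))
    (g : EuclideanSpace ℝ (Fin 5) → ENNReal),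
    A ⊆ {z : EuclideanSpace ℝ (Fin 6) | ∑ i : Fin 5, z (Fin.castSucc i) ^ 2 = 1} →
    (∀ z ∈ A, z 5 ≤ b) → Measurable g →
    ∫⁻ w in (fun z : EuclideanSpace ℝ (Fin 6) =>
      (WithLp.toLp 2 (fun i : Fin 5 => Real.exp (z 5) * z (Fin.castSucc i)) :
        EuclideanSpace ℝ (Fin 5))) '' A, g w ∂μHE[4] ≤
      ENNReal.ofReal (Real.exp (4 * b)) *
        ∫⁻ z in A, g ((WithLp.toLp 2 (fun i : Fin 5 => Real.exp (z 5) * z (Fin.castSucc i)) :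
          EuclideanSpace ℝ (Fin 5))) ∂μHE[4] :=
  fun _ _ _ hA hb hg => setLIntegral_conformalMap_image_le
    (Φ := fun z : EuclideanSpace ℝ (Fin 6) =>
      (WithLp.toLp 2 (fun i : Fin 5 => Real.exp (z 5) * z (Fin.castSucc i)) :
        EuclideanSpace ℝ (Fin 5))) conformalMap_apply_eq_smul hA hb hg

end Summit.SmoothPoincare4.SmoothPoincare4.Theorems.CylinderEntropySliceIsolation
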